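/-
Copyright (c) 2026 the pub-hodgecm-mathlib formalisation cell (harness21).  Prover seat hodgecm-mathlib-K2E3-p04 (g0), Track B ∕ K2-LIT
(build stream 29), h413 = `stmt-HodgeConjecture-24833`, line `K2_E3_EllipticInputs`, unit U4 «Keys» — DEAL `K2E3RankOneIntertwiningIntegral`, corollary
«THE INTERTWINING INTEGRAL SPANS `Hom_G(i(χ), i(wχ))`».  2026-09-03.
-/
import Summits.HodgeConjecture.HodgeConjecture.Theorems.K2E3RankOneIntertwiningIntegralConvergence  -- ★ RUNG 3 (this seat, p855375): `exists_intertwiningIntegral_of_modulus`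
import Summits.HodgeConjecture.HodgeConjecture.Theorems.K2E3IntertwinerSpaceDimLeOne               -- ★ row #7 (K2E3-p07, p855215): `intertwinerSpaceDimLeOne` (`dim Hom_G(i(χ), i(wχ)) ≤ 1`, `χ` regular)
import Summits.HodgeConjecture.HodgeConjecture.Theorems.K2E3NonUnitaryCharacterDichotomy           -- ★ (K2E3-p05, p855108): `cmTorusCharPair_ne_weyl_of_exists_norm_ne_one` (non-unitary ⇒ regular)
import HarnessLib

/-!
# h413 ∕ Track B «K2-LIT», unit U4 «Keys», DEAL `K2E3RankOneIntertwiningIntegral` — corollary: for `|χ₁| = ‖·‖_E^σ`, `σ > 0`, the intertwining integral `J(w, χ)`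
# SPANS `Hom_G(i_G(χ₁, χ₂), i_G(χ̄₁⁻¹, χ₂))`: every `G`-map `i(χ) → i(wχ)` is `c · J(w, χ)`  [Keys1984 §3; BernsteinZelevinsky1977 Thm. 2.9; Casselman1995 §6.4]

Cell `pub/hodgecm-mathlib`, crux H413 = `stmt-HodgeConjecture-24833` (lane `--supports … --as helper`), route HCCMUnconditional; dealer K2E3-plan (g1).  THEOREMS ONLY
(0 def ∕ 0 instance ∕ 0 notation ∕ 0 sorry); ★-only imports; a helper of this seat's own deal («THE» standard intertwining operator of the U4 road is now a canonical
object up to a scalar: K2E3-p05's `γ(χ)` in `J(w⁻¹, wχ) J(w, χ) = γ(χ)·id` is well defined on the convergent cone).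

THE MATHEMATICS.  `v` non-split, `χ = (χ₁, χ₂)` continuous with `‖χ₁(x)‖ = ‖x‖^σ`, `σ > 0`.  (1) `χ` is NON-UNITARY (`‖χ₁(α)‖ = ‖α‖^σ < 1` at a unit `α` of modulus `< 1`,
★ `exists_map_eq_unitModulusChar_lt_one`), hence REGULAR `χ ≠ wχ` (★ `cmTorusCharPair_ne_weyl_of_exists_norm_ne_one`, [Keys1984 §7: «`wλ = λ` iff `λ(x x̄) = 1`»]);
(2) ★ RUNG 3 gives `J = J(w, χ) ≠ 0` with `(J f)(g) = ∫_N f(w₀ n g) dμ`; (3) ★ row #7 `dim Hom_G(i(χ), i(wχ)) ≤ 1` for regular `χ`: every `A` is `c · J`.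
* §1 **`exists_intertwiningIntegral_spans_hom`** — `∃ J ≠ 0` with the integral formula AND `∀ A : i(χ) →_G i(wχ), ∃ c, A = c · J` (pointwise).
[cite: Keys1984, §3 Thms. 1–2, §7 p. 126] [cite: BernsteinZelevinsky1977, Thm. 2.9, Prop. 1.9 (b)] [cite: Casselman1995, §6.4 Thm. 6.4.1, pp. 62–64] [cite: Rogawski1990, §12.2 p. 173]

HONEST LABEL.  HC_CM is proved only modulo the 7 printed citations (2 remaining named inputs: hLiu418 = `stmt-HodgeConjecture-24832`, h413 = `stmt-HodgeConjecture-24833`) until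
rung 0 closes; count-neutral.

## References
* [Keys1984] D. Keys, *Principal series representations of special unitary groups over local fields*, Compositio Math. 51 (1984), §3 Thms. 1–2, §7 p. 126.
* [BernsteinZelevinsky1977] I. N. Bernstein, A. V. Zelevinsky, Ann. Sci. ÉNS 10 (1977), Prop. 1.9 (b), Thm. 2.9.
* [Casselman1995] W. Casselman, *Introduction to the theory of admissible representations of `p`-adic reductive groups* (1995), §6.4 Thm. 6.4.1 pp. 62–64.
* [Rogawski1990] J. D. Rogawski, *Automorphic Representations of Unitary Groups in Three Variables* (1990), §12.2 p. 173.
-/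

set_option autoImplicit false
-- the mandated namespace repeats the single-problem summit's segment (`HodgeConjecture.HodgeConjecture`)
set_option linter.dupNamespace false

noncomputable section

open NumberField IsDedekindDomain MeasureTheory
open scoped Matrix NNReal ENNReal

open Literature.NumberTheory Literature.NumberTheory.Automorphic Literature.NumberTheory.Automorphic.UnitaryGroup

namespace Summit.HodgeConjecture.HodgeConjecture.Cruxes.H413.K2E3IntertwiningIntegralSpansHom

variable (L : Type) [Field L] [NumberField L] [IsCMField L] (v : HeightOneSpectrum (𝓞 ↥(maximalRealSubfield L)))
  (hns : ∀ w : PlacesOver L v, IsCMField.complexConj L • w.1 = w.1)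

/-- **`|χ₁| = ‖·‖^σ` with `σ > 0` is NON-UNITARY**: at a unit `α` of modulus `‖α‖ < 1` (★ `exists_map_eq_unitModulusChar_lt_one`) one has `‖χ₁(α)‖ = ‖α‖^σ < 1`.
[cite: Keys1984, §7 p. 126] -/
theorem exists_norm_ne_one_of_modulus (χ₁ : (LocalRing L v)ˣ →* ℂˣ) {σ : ℝ} (hσ : 0 < σ)
    (hχ₁ : ∀ x : (LocalRing L v)ˣ, ‖((χ₁ x : ℂˣ) : ℂ)‖ = ((unitModulusChar (LocalRing L v) x : ℝ≥0) : ℝ) ^ σ) :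
    ∃ x : (LocalRing L v)ˣ, ‖((χ₁ x : ℂˣ) : ℂ)‖ ≠ 1 := by
  obtain ⟨α, -, hα⟩ := exists_map_eq_unitModulusChar_lt_one L v (conjLocal L (IsCMField.complexConj L) v)
  refine ⟨α, ne_of_lt ?_⟩
  rw [hχ₁]
  exact Real.rpow_lt_one (NNReal.coe_nonneg _) (by rw [← NNReal.coe_one]; exact NNReal.coe_lt_coe.2 hα) hσ

set_option synthInstance.maxHeartbeats 400000 in
set_option maxHeartbeats 8000000 in
-- statement∕proof over the two `SmoothInd` carriers of ★ `cmPrincipalSeries` (class of ★ `intertwinerSpaceDimLeOne` ∕ ★ RUNG 3)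
include hns in
/-- **THE INTERTWINING INTEGRAL SPANS `Hom_G(i_G(χ₁, χ₂), i_G(χ̄₁⁻¹, χ₂))`.**  `G = U(Φ₃)(L⁺_v)`, `v` NON-SPLIT, `w₀` of matrix `Φ₃`, `μ` any Haar measure of `N(L⁺_v)`, `χ₁, χ₂`
continuous with `‖χ₁(x)‖ = ‖x‖_E^σ`, **`σ > 0`**: there is `J : i_G(χ₁, χ₂) →_G i_G(χ̄₁⁻¹, χ₂)`, `J ≠ 0`, `(J f)(g) = ∫_N f(w₀ n g) dμ(n)` (★ RUNG 3
`exists_intertwiningIntegral_of_modulus`), and **every `G`-map `A : i_G(χ₁, χ₂) → i_G(χ̄₁⁻¹, χ₂)` is a scalar multiple of `J`** — `χ` is regular (§1 + ★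
`cmTorusCharPair_ne_weyl_of_exists_norm_ne_one`) so ★ `intertwinerSpaceDimLeOne` applies.  (Bruhat ∕ Keys: `Hom_G(i(λ), i(wλ)) = ℂ · A(w, λ)` on the convergent cone.)
[cite: Keys1984, §3 Thms. 1–2] [cite: BernsteinZelevinsky1977, Thm. 2.9] [cite: Casselman1995, §6.4 Thm. 6.4.1 pp. 62–64] [cite: Rogawski1990, §12.2 p. 173] -/
theorem exists_intertwiningIntegral_spans_hom
    (χ₁ : (LocalRing L v)ˣ →* ℂˣ) (χ₂ : ↥(normOneUnits (conjLocal L (IsCMField.complexConj L) v)) →* ℂˣ)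
    (h₁ : Continuous fun x => ((χ₁ x : ℂˣ) : ℂ)) (h₂ : Continuous fun x => ((χ₂ x : ℂˣ) : ℂ)) {σ : ℝ} (hσ : 0 < σ)
    (hχ₁ : ∀ x : (LocalRing L v)ˣ, ‖((χ₁ x : ℂˣ) : ℂ)‖ = ((unitModulusChar (LocalRing L v) x : ℝ≥0) : ℝ) ^ σ)
    (w₀ : ↥(unitaryGroupOfForm (conjLocal L (IsCMField.complexConj L) v) (cmLocalForm L 3 v))) (hw₀ : Units.val (w₀ : GL (Fin 3) (LocalRing L v)) = cmLocalForm L 3 v)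
    [MeasurableSpace ↥(cmBorelTriple L 3 v).N] [BorelSpace ↥(cmBorelTriple L 3 v).N] (μ : Measure ↥(cmBorelTriple L 3 v).N) [μ.IsHaarMeasure] :
    ∃ J : (cmPrincipalSeries L 3 v (cmTorusCharPair L v χ₁ χ₂)).IntertwiningMap
        (cmPrincipalSeries L 3 v (cmTorusCharPair L v (conjInvChar (conjLocal L (IsCMField.complexConj L) v) χ₁) χ₂)),
      J ≠ 0 ∧
      (∀ (f : haveI := locallyCompactSpace_cmBorelU L 3 v
          Representation.SmoothInd (cmBorelTriple L 3 v).P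
        (Representation.twist
          (((Representation.trivial ℂ ↥(torusU (conjLocal L (IsCMField.complexConj L) v) (cmLocalForm L 3 v)) ℂ).twist
            (cmTorusCharPair L v χ₁ χ₂)).comp (cmBorelTriple L 3 v).proj) (rootDeltaChar (cmBorelTriple L 3 v).P)))
        (g : ↥(unitaryGroupOfForm (conjLocal L (IsCMField.complexConj L) v) (cmLocalForm L 3 v))),
        (J f).toFun g = ∫ n : ↥(cmBorelTriple L 3 v).N, f.toFun (w₀ * (n : ↥(unitaryGroupOfForm (conjLocal L (IsCMField.complexConj L) v) (cmLocalForm L 3 v))) * g) ∂μ) ∧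
      ∀ A : (cmPrincipalSeries L 3 v (cmTorusCharPair L v χ₁ χ₂)).IntertwiningMap
          (cmPrincipalSeries L 3 v (cmTorusCharPair L v (conjInvChar (conjLocal L (IsCMField.complexConj L) v) χ₁) χ₂)),
        ∃ c : ℂ, ∀ x, A.toLinearMap x = c • J.toLinearMap x := by
  obtain ⟨J, hJ, hJint⟩ := K2E3RankOneIntertwiningIntegralConvergence.exists_intertwiningIntegral_of_modulus L v hns χ₁ χ₂ h₁ h₂ hσ hχ₁ w₀ hw₀ μ
  have hreg := K2E3NonUnitaryCharacterDichotomy.cmTorusCharPair_ne_weyl_of_exists_norm_ne_one L v hns χ₁ χ₂ h₁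
    (exists_norm_ne_one_of_modulus L v χ₁ hσ hχ₁)
  exact ⟨J, hJ, hJint, fun A => K2E3IntertwinerSpaceDimLeOne.intertwinerSpaceDimLeOne L v hns χ₁ χ₂ h₁ h₂ hreg J A hJ⟩

end Summit.HodgeConjecture.HodgeConjecture.Cruxes.H413.K2E3IntertwiningIntegralSpansHom

end
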